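import Summits.CriticalPhenomena.Ising3DConformalLimit.Theorems.CoerciveSharpnessCoerciveReflectedGradientDefs
import Literature.Probability.LatticeModels.CriticalTwoPointLower
import HarnessLib

/-!
# Route `CoerciveSharpness`, crux `CoerciveReflectedGradient` (stmt-CriticalPhenomena-18197), line `base_box_rerun`:
# registered stub `stub_reflectedSumIdentity`

`theorem stub_reflectedSumIdentity : Sig.stub_reflectedSumIdentity` (vocabulary in
`Theorems/CoerciveSharpnessCoerciveReflectedGradientDefs.lean`): on `ℤ³` at `β_c` the six direction terms
`Σ_{x,y ∈ Λ_n} 𝟙[y ∼ x] (G x − G(𝓡_δ x)) G(𝓡_δ y − y)` (`G = ⟨σ₀σ_·⟩_{β_c}`, `δ ∈ Fin 3 × Bool`) of the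
infinite-volume inequality of the line (stub C, the tree's form) add up to `6 · Qcrux n`, where `Qcrux n` is
VERBATIM the reflected gradient of the crux consequent (sum over `x ∈ Λ_n` and its `2d` neighbours
`x ± e_i ∈ Λ_n`, reflection written `Function.update · 0 (2n - ·₀)`, pair correlation written
`freeExpect 3 β_c 0 (spinPair y (𝓡 y))`).

Proof: the tree's direction symmetry `DCPNearCritical.direction_sum_eq` (hyperoctahedral invariance,
Duminil-Copin–Panis 2025 §2.2, proof of Lemma 2.4) makes every direction term equal to the `(0, +)` one; the
`(0, +)` term is `Qcrux n` by pure finite re-indexing of `{y ∈ Λ_n : y ∼ x}` as the injective image of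
`{(i, ±) : x ± e_i ∈ Λ_n}` (`neighborFinset_zdGraph_eq_image`, `single_signedUnit_injective`), the identification
`dirRefl (0, +) n = dcpReflect 0 n = Function.update · 0 (2n - ·₀)` (`DCPNearCritical.dirRefl_true_eq_dcpReflect`)
and translation invariance `⟨σ_yσ_z⟩ = ⟨σ₀σ_{z-y}⟩` (`freePair_eq_twoPointFree_sub`, `β_c ≥ 0` by
`criticalBeta_pos_holds`). Helper file (`--supports stmt-CriticalPhenomena-18197`); no definition, no named fact
as hypothesis.
-/

noncomputable section

open Finset

namespace Summit.CriticalPhenomena.Ising3DConformalLimit.Cruxes.CoerciveReflectedGradient.BaseBoxRerun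

open scoped BigOperators Classical
open Literature.Probability.LatticeModels
open Literature.Probability.LatticeModels.DCPLower
open Literature.Probability.LatticeModels.DCPNearCritical

variable {d : ℕ}

/-- **The neighbours of `x` inside the box, as an injective image**: `{y ∈ Λ_n : y ∼ x}` is the image of
`{(i, ±) : x ± e_i ∈ Λ_n}` under `(i, ±) ↦ x ± e_i` (`neighborFinset_zdGraph_eq_image`). [folklore] -/
theorem filter_box_adj_eq_image (n : ℕ) (x : Site d) :
    (box d n).filter (fun y => (zdGraph d).Adj x y) =
      ((univ : Finset (Fin d × Bool)).filter
          fun p => x + Pi.single p.1 (if p.2 then 1 else -1) ∈ box d n).image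
        fun p => x + Pi.single p.1 (if p.2 then 1 else -1) := by
  ext y
  rw [Finset.mem_filter, ← SimpleGraph.mem_neighborFinset, neighborFinset_zdGraph_eq_image, Finset.mem_image,
    Finset.mem_image]
  constructor
  · rintro ⟨hy, p, -, rfl⟩
    exact ⟨p, Finset.mem_filter.2 ⟨Finset.mem_univ _, hy⟩, rfl⟩
  · rintro ⟨p, hp, rfl⟩
    exact ⟨(Finset.mem_filter.1 hp).2, p, Finset.mem_univ _, rfl⟩

/-- **Re-indexing the neighbour sum**: for any `f`, `Σ_{y ∈ Λ_n} 𝟙[y ∼ x] f y = Σ_i (𝟙[x + e_i ∈ Λ_n] f (x + e_i) +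
𝟙[x - e_i ∈ Λ_n] f (x - e_i))` — the `2d` neighbours `x ± e_i` of `x` are pairwise distinct
(`single_signedUnit_injective`). [folklore] -/
theorem sum_box_adj_ite_eq (n : ℕ) (x : Site d) (f : Site d → ℝ) :
    ∑ y ∈ box d n, (if (zdGraph d).Adj x y then f y else 0) =
      ∑ i : Fin d, ((if x + Pi.single i 1 ∈ box d n then f (x + Pi.single i 1) else 0) +
        (if x - Pi.single i 1 ∈ box d n then f (x - Pi.single i 1) else 0)) := by
  rw [← Finset.sum_filter, filter_box_adj_eq_image n x, Finset.sum_image, Finset.sum_filter,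
    Fintype.sum_prod_type]
  · refine Finset.sum_congr rfl fun i _ => ?_
    simp only [Fintype.sum_bool, if_true, Bool.false_eq_true, if_false, Pi.single_neg, ← sub_eq_add_neg]
  · intro p _ q _ h
    exact single_signedUnit_injective (add_left_cancel h)

/-- **The `(0, +)` direction reflection written out**: `dirRefl (0, +) n z = Function.update z 0 (2n - z 0)`
(`= dcpReflect 0 n z` by `DCPNearCritical.dirRefl_true_eq_dcpReflect`, and the definition of `dcpReflect`). [folklore] -/
theorem dirRefl_zero_true_eq_update (n : ℤ) (z : Site 3) :
    dirRefl ((0 : Fin 3), true) n z = Function.update z (0 : Fin 3) (2 * n - z 0) := by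
  rw [dirRefl_true_eq_dcpReflect]
  rfl

/-- **The `(0, +)` direction term is the crux's reflected gradient**:
`Σ_{x,y ∈ Λ_n} 𝟙[y ∼ x] (G x − G(𝓡_{(0,+)} x)) G(𝓡_{(0,+)} y − y) = Qcrux n` on `ℤ³` at `β_c` — re-indexing of the
neighbour sum (`sum_box_adj_ite_eq`), `𝓡_{(0,+)} = Function.update · 0 (2n - ·₀)` and translation invariance
`freeExpect 3 β_c 0 (spinPair y z) = G (z - y)` (`freePair_eq_twoPointFree_sub`, `0 ≤ β_c(3)`). [folklore] -/
theorem base_direction_sum_eq_qcrux (n : ℕ) :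
    ∑ x ∈ box 3 n, ∑ y ∈ box 3 n, (if (zdGraph 3).Adj x y then
        (twoPointFree 3 (criticalBeta 3) x - twoPointFree 3 (criticalBeta 3) (dirRefl ((0 : Fin 3), true) n x)) *
          twoPointFree 3 (criticalBeta 3) (dirRefl ((0 : Fin 3), true) n y - y) else 0) = Qcrux n := by
  have hβ : 0 ≤ criticalBeta 3 := (criticalBeta_pos_holds (d := 3) (by norm_num)).le
  have hfe : ∀ y z : Site 3, freeExpect 3 (criticalBeta 3) 0 (spinPair y z) =
      twoPointFree 3 (criticalBeta 3) (z - y) := fun y z => freePair_eq_twoPointFree_sub hβ y z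
  unfold Qcrux
  refine Finset.sum_congr rfl fun x _ => ?_
  rw [sum_box_adj_ite_eq n x fun y => (twoPointFree 3 (criticalBeta 3) x -
      twoPointFree 3 (criticalBeta 3) (dirRefl ((0 : Fin 3), true) n x)) *
    twoPointFree 3 (criticalBeta 3) (dirRefl ((0 : Fin 3), true) n y - y)]
  refine Finset.sum_congr rfl fun i _ => ?_
  simp only [hfe, dirRefl_zero_true_eq_update]

/-- **Registered stub `stub_reflectedSumIdentity` of line `base_box_rerun`, proved**: the six direction terms of
the infinite-volume inequality on `ℤ³` at `β_c` are all equal to the `(0, +)` one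
(`DCPNearCritical.direction_sum_eq`, hyperoctahedral invariance — Duminil-Copin–Panis 2025, §2.2, proof of
Lemma 2.4 and eq. (2.8)), and the `(0, +)` one is the crux's `Qcrux n` (`base_direction_sum_eq_qcrux`); hence the
direction sum equals `6 · Qcrux n`. [cite: DuminilCopinPanis2025LowerBounds, §2.2, eq. (2.8)] -/
theorem stub_reflectedSumIdentity : Sig.stub_reflectedSumIdentity := by
  intro n
  rw [Finset.sum_congr rfl fun δ _ => direction_sum_eq (criticalBeta 3) (0 : Fin 3) δ n, Finset.sum_const,
    Finset.card_univ, Fintype.card_prod, Fintype.card_fin, Fintype.card_bool, nsmul_eq_mul,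
    base_direction_sum_eq_qcrux n]
  norm_num

end Summit.CriticalPhenomena.Ising3DConformalLimit.Cruxes.CoerciveReflectedGradient.BaseBoxRerun

end
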